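import Summits.BirchSwinnertonDyer.BirchSwinnertonDyer.Theorems.PrintCFramBottomClassIndexLawFiveLeFlipRungTwoOddCut
import Summits.BirchSwinnertonDyer.BirchSwinnertonDyer.Theorems.PrintCFramBottomClassIndexLawFiveLeThetaQExpansion
import Summits.BirchSwinnertonDyer.BirchSwinnertonDyer.Theorems.PrintCFramBottomClassIndexLawFiveLeFlipRungTransport
import HarnessLib

/-!
# Crux `PrintCFram.BottomClassIndexLawFiveLe` (stmt-BirchSwinnertonDyer-20372), line `eisenstein-resource-bdp-line` (registry v29 `stub_flipRungs.2`,
# the `8 ∣ m` half = LEAD's residual `stub_rungTwoEight` / w6 g10's (JMLTwoEight⁶)):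
# THE 2-ADIC FLIPPED-CUSP RUNG FOR `e = 3` — THE VEHICLE: THE EVEN CLASS CUT AT MODULUS `16` IS A HALF-INTEGRAL-WEIGHT FORM,
# AND `V = P_c g · θ(16·)` IS A `Γ₁`-FORM WITH `p`-DIVISIBLE `q`-EXPANSION UNDER THE CLASS HYPOTHESIS
# (cell `bsd-print-cfram`, width seat `bsd-line-cfram-p1-w5` g9; THEOREMS ONLY, `--supports` 20372 `--as helper`; BSD is not proved by any of this)

HONEST FRAMING. Nothing here is a statement about BSD, elliptic curves or Bernoulli numbers; no registered stub is closed. This is the `R = 16`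
twin of w7 g9's (A1) `…FlipRungTwoVehicle` for the `e = 3` (`8 ∣ m`) road of w8 g10 (HOME/STATUS 2026-08-29T11:14:53Z; pieces P6a–P6e
`…FlipRungTwoEight{FlipIdentity,Weights,Junk,ThetaFactor}`): the Katz vehicle is the PRODUCT `V = P·θ(16·)` with
`P = P_c g := Σ_{j<16} (e(−cj/16)/16)·g(· + j/16)` the class cut at modulus `16` of `g = G|U_4` (weights written EXACTLY as in P6b/P6c:
`cexp (-(2π I (c·j)/16)) / 16`, translates `((j : ℝ)/16) +ᵥ z`, `j ∈ Finset.range 16`). THE ONE OBSERVATION: the `e = 3` rung reads only the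
classes `c ≡ 2 (mod 4)` — EVEN classes — and for even `c` the weights `b(t) = 16⁻¹ψ₁₆(−ct)` are SQUARE-CLASS INVARIANT (`b(u²t) = b(t)` for every
unit `u` of `ℤ/16`: `u² ∈ {1, 9}`, `8c ≡ 0 (mod 16)`), so w7 g9's (M1) `sqClassAverage_mem_halfIntModularForms` at `Q = 16` applies:
**`P_c g ∈ M_{K/2}(N·16², χ)` for every `g ∈ M_{K/2}(N, χ)`, `4 ∣ N`, `c` even** — obstruction (O2) of the T6 notes («no `Γ₀` class projection
beyond modulus `8`») concerns ODD classes mod `16` only, which this rung never reads. Consequently the vehicle is the verbatim twin of (A1):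

* §1 finite bookkeeping: `2(u² − 1) = 0` for units of `ℤ/16`; even classes are unit-square stable; the weights are square-class invariant;
  orthogonality `Σ_t 16⁻¹ψ₁₆(−ct)ψ₁₆(tn) = 𝟙[n ≡ c (16)]`; the weight in P6b's `cexp` spelling.
* §2 `classCutSixteen_eq_sqClassAverage` (reindexing `ℤ/16 ≃ {0,…,15}`), **`classCutSixteen_mem_halfIntModularForms`** (`c` even),
  **`qCoeffs_classCutSixteen`** (`= 𝟙[n ≡ c (16)]·qCoeffs g n`, any `c`), `hasSum_classCutSixteen`.
* §3 `exists_modularForm_eq_mul_thetaMul_sixteen` (the NF-A socket `exists_modularForm_mul_thetaMul_sq_pow_qExpansion` at `Q = 4`, `p = 1`: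
  `f ∈ ModularForm (Gamma1 L) (k+1)`, `f = P·θ(16·)`, `qExpansion 1 f = qExpansion 1 P · Θ₁₆`, `64 ∣ L`), `exists_vehicleSixteen_of_coeff_mem`
  (input congruence by T4 `forall_coeff_mul`), and **`exists_classVehicleSixteen_of_class_hypothesis`**: for `g ∈ M_{(2k+1)/2}(N_g, χ)`, `c` even
  and the CLASS HYPOTHESIS «`qCoeffs g n ∈ p·ℤ̄[1/N]` for `n ≡ c (mod 16)`», an `f : ModularForm (Gamma1 (N_g·16²)) (k+1)` with
  `f z = P_c g(z)·θ(16z)` and every coefficient of `qExpansion 1 f` in `p·ℤ̄[1/N]` — the `f`/`hf`/`hcoef` inputs of the bracket + NF-Q transport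
  at `W₁₆` (P6f), whose periodicity hypothesis `P ∈ halfIntModularForms (2k+1) N_P ψ` is §2 with `N_P = N_g·16²`.

No definitions, no named facts, no `sorry`. beyond-print theorem: NO (Shimura 1973 §1 bookkeeping). References: [Shimura1973HalfIntegral] §1,
Prop. 1.3–1.5; [Katz1973] §1.6 (currency only); crux notes w7g8-T6 §5b–§5d (O2, P6); w8 g10 STATUS 11:14:53Z (the `R = 16` road).
-/

set_option autoImplicit false
-- summit-side namespace `Summit.BirchSwinnertonDyer.BirchSwinnertonDyer.…` (single-conjunct summit, D-0017 layout)
set_option linter.dupNamespace false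

noncomputable section

open UpperHalfPlane hiding I
open Complex CongruenceSubgroup PowerSeries
open scoped MatrixGroups NumberTheorySymbols Real ModularForm
open Literature.NumberTheory.EllipticCurves.ModularForms
open Literature.NumberTheory.EllipticCurves.Tunnell1983 (thetaMul)

namespace Summit.BirchSwinnertonDyer.BirchSwinnertonDyer.Theorems.PrintCFram.FlipRung

open Summit.BirchSwinnertonDyer.BirchSwinnertonDyer.Theorems.PrintCFram.HalfIntegralBridge

/-! ## §1 Finite bookkeeping at modulus `16`: even classes are square-class invariant -/

/-- For a unit `u` of `ℤ/16`, `2·(u² − 1) = 0` (`u² ∈ {1, 9}`). [folklore] -/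
theorem two_mul_sq_sub_one_eq_zero_of_isUnit_sixteen (u : ZMod 16) (hu : IsUnit u) : 2 * (u ^ 2 - 1) = 0 := by
  obtain ⟨v, hv⟩ := hu.exists_right_inv
  have key : ∀ u v : ZMod 16, u * v = 1 → 2 * (u ^ 2 - 1) = 0 := by decide
  exact key u v hv

/-- **Even classes mod `16` are stable under unit squares**: `c·(u²t) = c·t` in `ℤ/16` for `c` even and `u` a unit. [folklore] -/
theorem natCast_mul_sq_mul_eq_of_even_sixteen {c : ℕ} (hc : 2 ∣ c) (u t : ZMod 16) (hu : IsUnit u) :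
    (c : ZMod 16) * (u ^ 2 * t) = (c : ZMod 16) * t := by
  obtain ⟨c₀, rfl⟩ := hc
  have h2 := two_mul_sq_sub_one_eq_zero_of_isUnit_sixteen u hu
  have h : ((2 * c₀ : ℕ) : ZMod 16) * (u ^ 2 * t) - ((2 * c₀ : ℕ) : ZMod 16) * t =
      (c₀ : ZMod 16) * t * (2 * (u ^ 2 - 1)) := by
    push_cast; ring
  rw [h2, mul_zero, sub_eq_zero] at h
  exact h

/-- **The class weights `16⁻¹·ψ₁₆(−c·t)` of an EVEN class `c` are square-class invariant** (`b(u²t) = b(t)` for units `u` — the hypothesis of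
M1 `sqClassAverage_mem_halfIntModularForms` at `Q = 16`; false for odd `c`: this is obstruction (O2) of the T6 notes, which the `e = 3` rung
never meets because it reads the classes `≡ 2 (mod 4)`). [folklore] -/
theorem classWeightSixteen_sq_mul {c : ℕ} (hc : 2 ∣ c) (u t : ZMod 16) (hu : IsUnit u) :
    (16 : ℂ)⁻¹ * ZMod.stdAddChar (-((c : ZMod 16) * (u ^ 2 * t))) = (16 : ℂ)⁻¹ * ZMod.stdAddChar (-((c : ZMod 16) * t)) := by
  rw [natCast_mul_sq_mul_eq_of_even_sixteen hc u t hu]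

/-- **Orthogonality at modulus `16`**: `Σ_{t mod 16} 16⁻¹ψ₁₆(−ct)·ψ₁₆(tn) = 𝟙[n ≡ c (mod 16)]`. [folklore] -/
theorem sum_classWeightSixteen_mul_stdAddChar (c n : ℕ) :
    ∑ t : ZMod 16, (16 : ℂ)⁻¹ * ZMod.stdAddChar (-((c : ZMod 16) * t)) * ZMod.stdAddChar (t * (n : ZMod 16)) =
      if n % 16 = c % 16 then 1 else 0 := by
  have h : ∀ t : ZMod 16, (16 : ℂ)⁻¹ * ZMod.stdAddChar (-((c : ZMod 16) * t)) * ZMod.stdAddChar (t * (n : ZMod 16)) =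
      (16 : ℂ)⁻¹ * ZMod.stdAddChar (t * ((n : ZMod 16) - (c : ZMod 16))) := by
    intro t
    rw [mul_assoc, ← AddChar.map_add_eq_mul]
    congr 2
    ring
  rw [Finset.sum_congr rfl (fun t _ ↦ h t), ← Finset.mul_sum, AddChar.sum_mulShift _ (ZMod.isPrimitive_stdAddChar 16),
    ZMod.card]
  by_cases hnc : n % 16 = c % 16
  · have h0 : (n : ZMod 16) - (c : ZMod 16) = 0 := sub_eq_zero.mpr ((ZMod.natCast_eq_natCast_iff' n c 16).mpr hnc)
    simp [h0, hnc]
  · have h0 : (n : ZMod 16) - (c : ZMod 16) ≠ 0 := fun h' ↦ hnc ((ZMod.natCast_eq_natCast_iff' n c 16).mp (sub_eq_zero.mp h'))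
    simp [h0, hnc]

/-- The weight `16⁻¹·ψ₁₆(−c·t)` written as P6b/P6c's `e(−c·j/16)/16` at `j = t.val`. [folklore] -/
theorem classWeightSixteen_eq_cexp (c : ℕ) (t : ZMod 16) :
    (16 : ℂ)⁻¹ * ZMod.stdAddChar (-((c : ZMod 16) * t)) = cexp (-(2 * π * I * ((c * t.val : ℕ) : ℂ) / 16)) / 16 := by
  have ht : -((c : ZMod 16) * t) = (((-((c * t.val : ℕ) : ℤ) : ℤ)) : ZMod 16) := by
    push_cast
    rw [ZMod.natCast_zmod_val]
  rw [ht, ZMod.stdAddChar_coe, div_eq_mul_inv, mul_comm]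
  congr 1
  congr 1
  push_cast
  ring

/-! ## §2 The class cut at modulus `16` as a square-class translate average -/

/-- **The class cut `P_c g(z) = Σ_{j<16} (e(−cj/16)/16)·g(z + j/16)` IS the translate average `T_b g` of M1 with `b(t) = 16⁻¹ψ₁₆(−ct)`**
(reindexing `ℤ/16 ≃ {0,…,15}`). [folklore] -/
theorem classCutSixteen_eq_sqClassAverage (g : ℍ → ℂ) (c : ℕ) :
    (fun z : ℍ ↦ ∑ j ∈ Finset.range 16, cexp (-(2 * π * I * ((c * j : ℕ) : ℂ) / 16)) / 16 * g ((((j : ℝ) / 16) +ᵥ z : ℍ))) =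
    fun z : ℍ ↦ ∑ t : ZMod 16, (16 : ℂ)⁻¹ * ZMod.stdAddChar (-((c : ZMod 16) * t)) *
      g (((((t.val : ℝ) / ((16 : ℕ) : ℝ) : ℝ)) +ᵥ z : ℍ)) := by
  funext z
  rw [← Fin.sum_univ_eq_sum_range
    (fun j : ℕ ↦ cexp (-(2 * π * I * ((c * j : ℕ) : ℂ) / 16)) / 16 * g ((((j : ℝ) / 16) +ᵥ z : ℍ))) 16]
  refine Finset.sum_congr rfl (fun t _ ↦ ?_)
  rw [classWeightSixteen_eq_cexp]
  rfl

/-- **THE EVEN CLASS CUT AT MODULUS `16` IS A FORM OF HALF-INTEGRAL WEIGHT**: for `g ∈ M_{K/2}(N, χ)` (`4 ∣ N`, any `K`) and `c` EVEN,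
`P_c g = Σ_{j<16} (e(−cj/16)/16)·g(· + j/16) ∈ M_{K/2}(N·16², χ)` — M1's `sqClassAverage_mem_halfIntModularForms` at `Q = 16` with the
square-class invariance of §1. (For ODD `c` this is false in general — obstruction (O2) of the T6 notes.)
[cite: Shimura1973HalfIntegral, §1, Prop. 1.3–1.5] -/
theorem classCutSixteen_mem_halfIntModularForms {K N : ℕ} {χ : DirichletCharacter ℂ N} (hN : 4 ∣ N) {g : ℍ → ℂ}
    (hg : g ∈ halfIntModularForms K N χ) {c : ℕ} (hc : 2 ∣ c) :
    (fun z : ℍ ↦ ∑ j ∈ Finset.range 16, cexp (-(2 * π * I * ((c * j : ℕ) : ℂ) / 16)) / 16 * g ((((j : ℝ) / 16) +ᵥ z : ℍ))) ∈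
      halfIntModularForms K (N * 16 ^ 2) (DirichletCharacter.changeLevel (dvd_mul_right N (16 ^ 2)) χ) := by
  rw [classCutSixteen_eq_sqClassAverage]
  exact sqClassAverage_mem_halfIntModularForms hN hg _ (fun u t hu ↦ classWeightSixteen_sq_mul hc u t hu)

/-- **THE `q`-EXPANSION OF THE CLASS CUT**: `qCoeffs (P_c g) n = 𝟙[n ≡ c (mod 16)]·qCoeffs g n` for `g ∈ M_{K/2}(N, χ)` (any class `c`).
[folklore] -/
theorem qCoeffs_classCutSixteen {K N : ℕ} {χ : DirichletCharacter ℂ N} {g : ℍ → ℂ} (hg : g ∈ halfIntModularForms K N χ) (c n : ℕ) :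
    qCoeffs (fun z : ℍ ↦ ∑ j ∈ Finset.range 16, cexp (-(2 * π * I * ((c * j : ℕ) : ℂ) / 16)) / 16 * g ((((j : ℝ) / 16) +ᵥ z : ℍ))) n =
      if n % 16 = c % 16 then qCoeffs g n else 0 := by
  rw [classCutSixteen_eq_sqClassAverage, qCoeffs_sqClassAverage hg]
  beta_reduce
  rw [sum_classWeightSixteen_mul_stdAddChar]
  split_ifs <;> simp

/-- The class cut as a `q`-series on `ℍ`: `P_c g(τ) = Σ_n 𝟙[n ≡ c (16)]·qCoeffs g n·e(nτ)`. [folklore] -/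
theorem hasSum_classCutSixteen {K N : ℕ} {χ : DirichletCharacter ℂ N} {g : ℍ → ℂ} (hg : g ∈ halfIntModularForms K N χ) (c : ℕ) (τ : ℍ) :
    HasSum (fun n : ℕ ↦ (if n % 16 = c % 16 then qCoeffs g n else 0) * Function.Periodic.qParam 1 (τ : ℂ) ^ n)
      (∑ j ∈ Finset.range 16, cexp (-(2 * π * I * ((c * j : ℕ) : ℂ) / 16)) / 16 * g ((((j : ℝ) / 16) +ᵥ τ : ℍ))) := by
  have h := hasSum_translateAverage (hasSum_qCoeffs hg) (fun t : ZMod 16 ↦ (16 : ℂ)⁻¹ * ZMod.stdAddChar (-((c : ZMod 16) * t))) τ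
  rw [show (∑ j ∈ Finset.range 16, cexp (-(2 * π * I * ((c * j : ℕ) : ℂ) / 16)) / 16 * g ((((j : ℝ) / 16) +ᵥ τ : ℍ))) =
      ∑ t : ZMod 16, (16 : ℂ)⁻¹ * ZMod.stdAddChar (-((c : ZMod 16) * t)) * g (((((t.val : ℝ) / ((16 : ℕ) : ℝ) : ℝ)) +ᵥ τ : ℍ))
    from congrFun (classCutSixteen_eq_sqClassAverage g c) τ]
  convert h using 2 with n
  rw [sum_classWeightSixteen_mul_stdAddChar]
  split_ifs <;> ring

/-! ## §3 The vehicle `V = P·θ(16·)` on `Γ₁(L)` and its input congruence -/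

/-- **THE PRODUCT VEHICLE AS A `Γ₁`-FORM.** For `P ∈ M_{(2k+1)/2}(L, ψ)` with `64 ∣ L` there are a Mathlib modular form `f` of weight `k + 1` on
`Γ₁(L)` and `Θ ∈ ℕ⟦q⟧` (the `q`-expansion of `θ(16·)`, constant term `1`) with `f z = P z · θ(16z)` and `qExpansion 1 f = qExpansion 1 P · Θ`
(the NF-A socket `exists_modularForm_mul_thetaMul_sq_pow_qExpansion` at `Q = 4`, `p = 1`). [cite: Shimura1973HalfIntegral, §1] -/
theorem exists_modularForm_eq_mul_thetaMul_sixteen {k L : ℕ} [NeZero L] (h64 : 64 ∣ L) {ψ : DirichletCharacter ℂ L} {P : ℍ → ℂ}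
    (hP : P ∈ halfIntModularForms (2 * k + 1) L ψ) :
    ∃ (f : ModularForm (Gamma1 L) ((k + 1 : ℕ) : ℤ)) (Θ : PowerSeries ℕ),
      (∀ z : ℍ, f z = P z * thetaMul 16 z) ∧ PowerSeries.coeff 0 Θ = 1 ∧
        qExpansion 1 ⇑f = qExpansion 1 P * Θ.map (Nat.castRingHom ℂ) := by
  obtain ⟨f, Θ, hf, hq, h0, -⟩ :=
    exists_modularForm_mul_thetaMul_sq_pow_qExpansion (Q := 4) (by norm_num) (by simpa using h64) (p := 1) odd_one hP
  refine ⟨f, Θ, fun z ↦ ?_, h0, by simpa using hq⟩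
  have h := congrFun hf z
  simp only [Pi.mul_apply, pow_one] at h
  rw [h]
  norm_num

/-- **AVATAR + INPUT SIDE.** If every `q`-expansion coefficient of `P ∈ M_{(2k+1)/2}(L, ψ)` (`64 ∣ L`) lies in `p·ℤ̄[1/N]`, the avatar `f` of
`P·θ(16·)` on `Γ₁(L)` has every coefficient of `qExpansion 1 f` in `p·ℤ̄[1/N]` (Cauchy product with the natural-number coefficients of `θ(16·)`;
T4 `forall_coeff_mul`) — the `hcoef` input of the NF-Q transport at the flipped cusp `W₁₆`. [cite: Katz1973, §1.6 Cor. 1.6.2] -/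
theorem exists_vehicleSixteen_of_coeff_mem {k L : ℕ} [NeZero L] (h64 : 64 ∣ L) {ψ : DirichletCharacter ℂ L} {P : ℍ → ℂ}
    (hP : P ∈ halfIntModularForms (2 * k + 1) L ψ) {N p : ℕ}
    (hcoefP : ∀ n : ℕ, ∃ y : ℂ, (∃ j : ℕ, IsIntegral ℤ ((N : ℂ) ^ j * y)) ∧ qCoeffs P n = (p : ℂ) * y) :
    ∃ f : ModularForm (Gamma1 L) ((k + 1 : ℕ) : ℤ), (∀ z : ℍ, f z = P z * thetaMul 16 z) ∧
      ∀ n : ℕ, ∃ y : ℂ, (∃ j : ℕ, IsIntegral ℤ ((N : ℂ) ^ j * y)) ∧ (qExpansion 1 ⇑f).coeff n = (p : ℂ) * y := by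
  obtain ⟨f, Θ, hf, -, hq⟩ := exists_modularForm_eq_mul_thetaMul_sixteen h64 hP
  refine ⟨f, hf, ?_⟩
  rw [hq]
  refine forall_coeff_mul (fun n ↦ ?_) (fun n ↦ ?_)
  · rw [← qCoeffs_apply]; exact hcoefP n
  · rw [PowerSeries.coeff_map]; exact exists_isIntegral_pow_mul_natCast _

/-- **THE VEHICLE OF THE `e = 3` RUNG UNDER THE CLASS HYPOTHESIS.** Let `g ∈ M_{(2k+1)/2}(N_g, χ)` (`4 ∣ N_g`; for the line: `g = G|U_4`, `G` the
AWAY₂′ cut of `H_k`), `c` an EVEN class mod `16` (for the line: `c = 2c₁`, `c₁` odd — the classes `≡ 2 (mod 4)` of the `e = 3` indices), and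
suppose the CLASS HYPOTHESIS of (JMLTwoEight⁶) in `g`-currency: `qCoeffs g n ∈ p·ℤ̄[1/N]` for every `n ≡ c (mod 16)`. Then with
`P := P_c g = Σ_{j<16} (e(−cj/16)/16)·g(· + j/16) ∈ M_{(2k+1)/2}(N_g·16², χ)` (§2) there is `f : ModularForm (Gamma1 (N_g·16²)) (k+1)` with
`f z = P z · θ(16z)` and every coefficient of `qExpansion 1 f` in `p·ℤ̄[1/N]` — the `f`, `hf`, `hcoef` inputs of the bracket/transport at `W₁₆`
(P6f), with `P`'s membership (for the bracket's periodicity) supplied by `classCutSixteen_mem_halfIntModularForms`.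
[cite: Katz1973, §1.6 Cor. 1.6.2] [cite: Shimura1973HalfIntegral, §1] -/
theorem exists_classVehicleSixteen_of_class_hypothesis {k N_g : ℕ} [NeZero N_g] (h4 : 4 ∣ N_g) {χ : DirichletCharacter ℂ N_g}
    {g : ℍ → ℂ} (hg : g ∈ halfIntModularForms (2 * k + 1) N_g χ) {c : ℕ} (hc : 2 ∣ c) {N p : ℕ}
    (hclass : ∀ n : ℕ, n % 16 = c % 16 → ∃ y : ℂ, (∃ j : ℕ, IsIntegral ℤ ((N : ℂ) ^ j * y)) ∧ qCoeffs g n = (p : ℂ) * y) :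
    ∃ f : ModularForm (Gamma1 (N_g * 16 ^ 2)) ((k + 1 : ℕ) : ℤ),
      (∀ z : ℍ, f z = (∑ j ∈ Finset.range 16, cexp (-(2 * π * I * ((c * j : ℕ) : ℂ) / 16)) / 16 * g ((((j : ℝ) / 16) +ᵥ z : ℍ))) *
        thetaMul 16 z) ∧
      ∀ n : ℕ, ∃ y : ℂ, (∃ j : ℕ, IsIntegral ℤ ((N : ℂ) ^ j * y)) ∧ (qExpansion 1 ⇑f).coeff n = (p : ℂ) * y := by
  have h64 : 64 ∣ N_g * 16 ^ 2 := Dvd.dvd.mul_left (by norm_num) N_g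
  refine exists_vehicleSixteen_of_coeff_mem h64 (classCutSixteen_mem_halfIntModularForms h4 hg hc) (fun n ↦ ?_)
  rw [qCoeffs_classCutSixteen hg c n]
  by_cases hn : n % 16 = c % 16
  · rw [if_pos hn]; exact hclass n hn
  · rw [if_neg hn]; exact exists_eq_natCast_mul_zero

end Summit.BirchSwinnertonDyer.BirchSwinnertonDyer.Theorems.PrintCFram.FlipRung

end
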